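import Summits.Ventures.AbcShadow.SH02.TraceCount

/-!
# Venture AbcShadow — SH-02 kernel point count at `ℓ = 41189`: `a_41189(2336a1) = a_41189(2336b1) = −284`

HONEST FRAMING. Kernel-certificate file of the work-bound cell `abc-shadow` (typer seat `abc-shadow-typ-2`); no
Diophantine statement, no claim on abc or on any summit, no side on IUT. One `decide +kernel` evaluation of the
Euler-criterion loop `traceCalc` of `SH02/TraceCount.lean` over the `41189` residues (≈ 2–3 minutes of kernel time,
hence its own file), giving the record's value `a_41189(2336a1) = −284` (inv-6 K4-73bis / crit-1 j319553 / third path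
97fd313139c017bc / eng-2 j320506) INSIDE the Lean kernel, and the twist `2336b1` by `apTrace_flipNeg`.
-/

namespace Summit.Ventures.AbcShadow

/-- Kernel evaluation: `−Σ_{x mod 41189} χ(x³ − 25x + 48) = −284`. [folklore] -/
theorem traceCalc_e2336a1_41189 : traceCalc 41189 (reduceMod 41189 e2336a1) = -284 := by
  decide +kernel

/-- **`a_41189(2336a1) = −284`** (kernel-checked point count; the record's value). [folklore] -/
theorem apTrace_e2336a1_41189 : apTrace 41189 (reduceMod 41189 e2336a1) = -284 := by
  haveI : Fact (Nat.Prime 41189) := ⟨prime_41189⟩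
  rw [apTrace_eq_traceCalc (by decide) _ rfl rfl delta_e2336a1_ne_zero.2, traceCalc_e2336a1_41189]

/-- **`a_41189(2336b1) = −284`** (the `−1`-twist has the same trace at `ℓ ≡ 1 (mod 4)`). [folklore] -/
theorem apTrace_e2336b1_41189 : apTrace 41189 (reduceMod 41189 e2336b1) = -284 := by
  haveI : Fact (Nat.Prime 41189) := ⟨prime_41189⟩
  rw [reduceMod_e2336b1, apTrace_flipNeg _ rfl rfl 13634 sqrtNegOne_41189, apTrace_e2336a1_41189]

end Summit.Ventures.AbcShadow
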